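import Mathlib
import HarnessLib
import Summits.BirchSwinnertonDyer.BirchSwinnertonDyer.Theses.ManinLocalTwoThree
import Literature.NumberTheory.EllipticCurves.HeegnerPoints

/-!
# Lines/honda_contraction.lean (v3 = REDUCTION DICHOTOMY, off-torsion observable) — skeleton line
`honda-contraction` for crux `ManinPrimeToThreeAtNine` (C3, stmt-BirchSwinnertonDyer-22968; route `ManinLocalTwoThree`; planner
bsd-f2-manin-imc g10, 2026-08-28; supersedes v2 a1173be6f568d1cc (shallow-value observable) and the g9 v1; idea card
`Cruxes/ManinPrimeToThreeAtNine/Ideas/honda-contraction.md`; informal proofs MEMO-imc §16 ((H)), §17 (v2), §18 (v3, level law);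
typed rows = HOME/imc/Sketch-imc-g10b.lean 4f2fc03f6024f20d, BC7 4/4 CLEAN (HOME/imc/bc7-probe-g10b.raw.txt)).

IDEA. (H) at an ADDITIVE prime `p` (`p² ∣ N`), any datum `D` (`φ_D^* ω = c · 2πi f dτ`): `p ∣ c ⟹ φ̄_D(C̄_∞) = {Ō}`
on the reduced outer Katz–Mazur component (Néron parameter `T(q) = exp_Ê(c Σ aₙqⁿ/n)`, `[p]_Ê ≡ 0 mod p`) and
`φ̄_D(C̄_0) = {T̄₀}`, `T₀ = φ_D(cusp 0) ∈ E(ℚ)_tors` (`w_N` swaps `C_∞, C_0`; `φ ∘ w_N = -φ + T₀`).  A Heegner point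
`x_Q` (CM by `𝓞_K`, `p` split by the Heegner hypothesis) reduces into `C̄_∞^{ord}` at primes over `𝔭 ∣ 𝔫` and into
`C̄_0^{ord}` at primes over `𝔭̄`.  Hence under `p ∣ c` EVERY Heegner value is `≡ O` or `≡ T₀ (mod 𝔓)` at EVERY
prime `𝔓 ∣ p` of its field of definition.  v3 OBSERVABLE: `P` is OFF the rational torsion at `𝔓` — for every
`T ∈ W(ℚ)_tors` (incl. `O`), `P - T = (x, y)` with `v_𝔓(x) ≥ 0`.  STUB 1 (theorem-candidate E-imc-47): an off-torsion
value forces `3 ∤ c` (only SIGNS of valuations are used: no unramifiedness, no `p`-torsion / Kosters–Pannekoek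
hypothesis, no formal-group level bookkeeping — strictly weaker hypothesis than v2's shallow value, which is
off-torsion).  STUB 2 (law E-imc-48, load-bearing): every lattice-optimal datum with `9 ∣ N` HAS an off-torsion
value; given the converse half of (H) (`p ∤ c ⟹ φ̄_D|C̄_∞` non-constant ⟹ cofinite image in `ℰ⁰_𝔽̄p = 𝔾_a`) it is
⟺ the crux for the datum.  LEVEL LAW (MEMO §18.1, why the data look as they do): `log_ω(φ_D x) = c · F_f(x)` with
`F_f = Σ_{p∤n} aₙqⁿ/n` a weight-0 `p`-adic modular function, integral and non-constant mod `p` (`a_p = 0`), so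
`v_𝔓(log_ω P_Q) = v_p(c)` for all but finitely many reductions; D-imc-12 sweep B (j296208): on every target with
`p ∣ u` the transported value sits at level exactly `v_p(u) = 1` at the `∞`-side prime, on every `p ∤ u` target it
is `𝔓`-integral there.
`ManinPrimeToThreeAtNine_of` is the kernel-checked composition (the printed-fact binders of the crux are not used).
-/

set_option autoImplicit false
set_option linter.dupNamespace false

noncomputable section

open scoped Classical
open WeierstrassCurve Literature.NumberTheory.EllipticCurves
  Literature.NumberTheory.EllipticCurves.ModularForms

namespace Summit.BirchSwinnertonDyer.BirchSwinnertonDyer.Cruxes.ManinPrimeToThreeAtNine.HondaContractionV3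

/-- `P` is `𝔓`-adically off the rational torsion (every `P - T`, `T ∈ W(ℚ)_tors`, affine with `𝔓`-integral `x`). -/
def OffRationalTorsionAt {W : WeierstrassCurve ℚ} (F : Type) [Field F] [NumberField F]
    (𝔓 : IsDedekindDomain.HeightOneSpectrum (NumberField.RingOfIntegers F))
    (P : (W.baseChange F).toAffine.Point) : Prop :=
  ∀ T : (W.baseChange ℚ).toAffine.Point, IsOfFinAddOrder T →
    ∃ (x y : F) (h : (W.baseChange F).toAffine.Nonsingular x y),
      P - WeierstrassCurve.Affine.Point.baseChange ℚ F T = WeierstrassCurve.Affine.Point.some x y h ∧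
      𝔓.valuation F x ≤ 1

/-- STUB 1 (E-imc-47 at `p = 3`; THEOREM-candidate, size L: KM outer components reduced + `w_N`; `q`-expansion
principle on `𝒳₀(N)^{sm}` at `∞`; `[p]_Ê ≡ 0 mod p` at additive `p`; Néron mapping property; CM reduction of
`x_Q` into the ordinary loci of `C̄_∞ / C̄_0`). -/
theorem stub_notDvdManin_of_offTorsionHeegnerValue :
    ∀ (W : WeierstrassCurve ℚ) [W.IsElliptic] [W.IsGloballyMinimal] {N : ℕ} [NeZero N]
      (D : ModularParametrizationData W N), 3 ^ 2 ∣ N →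
      ∀ (K : Type) [Field K] [NumberField K], IsImaginaryQuadratic K → SatisfiesHeegnerHypothesis N K →
      ∀ (H : HeegnerDatum N (NumberField.discr K)) (Q : ℤ × ℤ × ℤ), Q ∈ H.reps →
      ∀ (F : Type) [Field F] [NumberField F] (ιℂ : F →+* ℂ)
        (𝔓 : IsDedekindDomain.HeightOneSpectrum (NumberField.RingOfIntegers F)),
        𝔓.valuation F (3 : F) < 1 →
      ∀ (P : (W.baseChange F).toAffine.Point),
        WeierstrassCurve.Affine.Point.map ιℂ.toRatAlgHom P = D.φ (heegnerTau Q) →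
        OffRationalTorsionAt F 𝔓 P → ¬ (3 : ℤ) ∣ D.maninConstant := by
  sorry

/-- STUB 2 (E-imc-48 at `p = 3`; LAW, size XL = the crux re-addressed as a SUPPLY statement, load-bearing). -/
theorem stub_offTorsionHeegnerValueSupply :
    ∀ (W : WeierstrassCurve ℚ) [W.IsElliptic] [W.IsGloballyMinimal] {N : ℕ} [NeZero N]
      (D : ModularParametrizationData W N),
      (∀ z ∈ D.L.lattice, ∃ w ∈ periodLattice D.f, z = D.c * w) → 3 ^ 2 ∣ N →
      ∃ (K : Type) (_ : Field K) (_ : NumberField K), IsImaginaryQuadratic K ∧ SatisfiesHeegnerHypothesis N K ∧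
      ∃ (H : HeegnerDatum N (NumberField.discr K)) (Q : ℤ × ℤ × ℤ), Q ∈ H.reps ∧
      ∃ (F : Type) (_ : Field F) (_ : NumberField F) (ιℂ : F →+* ℂ)
        (𝔓 : IsDedekindDomain.HeightOneSpectrum (NumberField.RingOfIntegers F)),
        𝔓.valuation F (3 : F) < 1 ∧
      ∃ (P : (W.baseChange F).toAffine.Point),
        WeierstrassCurve.Affine.Point.map ιℂ.toRatAlgHom P = D.φ (heegnerTau Q) ∧ OffRationalTorsionAt F 𝔓 P := by
  sorry

/-- COMPOSITION (no sorry): the two stubs give the crux BY NAME. -/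
theorem ManinPrimeToThreeAtNine_of :
    Summit.BirchSwinnertonDyer.BirchSwinnertonDyer.Theses.ManinLocalTwoThree.ManinPrimeToThreeAtNine := by
  intro hM hAU hC hnf W _ _ N _ D hopt hdiv
  obtain ⟨K, _, _, hK, hHH, H, Q, hQ, F, _, _, ιℂ, 𝔓, h𝔓, P, hP, hoff⟩ :=
    stub_offTorsionHeegnerValueSupply W D hopt hdiv
  exact stub_notDvdManin_of_offTorsionHeegnerValue W D hdiv K hK hHH H Q hQ F ιℂ 𝔓 h𝔓 P hP hoff

end Summit.BirchSwinnertonDyer.BirchSwinnertonDyer.Cruxes.ManinPrimeToThreeAtNine.HondaContractionV3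

end
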